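import Summits.HodgeConjecture.HodgeConjecture.Theses.PeriodsPolice
import Literature.AlgebraicGeometry.Motives.WeilCohomologyProofs
import Literature.AlgebraicGeometry.HodgeTheory.HardLefschetzNFold
import Literature.AlgebraicGeometry.HodgeTheory.RationalClassesRingChange

/-!
# Birth skeleton of piece P2 `BettiHardLefschetz` : `∀ B : BettiHodgeData ℂ, B.W.HasHardLefschetz`

Two stubs and the kernel-checked composition `BettiHardLefschetz_of`:
* `stub_hasHardLefschetzProperty_ringChange_iso` — the complexified image `ι(B.iso η) ∈ H²(X(ℂ); ℂ)` of
  any `W`-hyperplane class has the hard Lefschetz property in dimension `n = dim X` (it is `t · ι*h`,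
  `t ≠ 0`, for the ample class of the embedding: `b₂(ℙᴺ(ℂ)) = 1`, `tr(ηⁿ) > 0`; Voisin I Thm. 6.25 —
  tree `nonempty_hardLefschetzNFold_holds` / `exists_hardLefschetzNFold_of_pullback_eq_fubiniStudy_smul`);
* `stub_ringChange_iso_lefschetzPow` — `ι ∘ B.iso` intertwines `W`'s Lefschetz iterates with the
  singular ones (`B.iso_cup`, `B.iso_one`, `ringChange` multiplicative);
composition: injectivity transports back along the injection `ι ∘ B.iso` (`ringChange_rat_injective`),
and injectivity is bijectivity by Poincaré duality (`WeilCohomology.hasHardLefschetz_iff_injective`).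
-/

set_option linter.dupNamespace false

namespace Summit.HodgeConjecture.HodgeConjecture.Cruxes.ClassicalBridge.PiecesSplit.P2

open Literature.AlgebraicGeometry.Motives Literature.AlgebraicGeometry.HodgeTheory
open Literature.AlgebraicTopology.SingularHomology Literature.Geometry.Kaehler

/-- Stub 1: the complexified comparison image of a `W`-hyperplane class has the hard Lefschetz property.
[VoisinHodgeI2002 Thm. 6.25; Kleiman1968 §1.4] -/
theorem stub_hasHardLefschetzProperty_ringChange_iso :
    ∀ (B : BettiHodgeData ℂ) ⦃n : ℕ⦄ ⦃X : SchemeOver ℂ⦄ (_hX : IsSmoothProjective n X) (η : B.W.obj X 2),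
      B.W.IsHyperplaneClass X η →
        HasHardLefschetzProperty
          (singularCohomology.ringChange (algebraMap ℚ ℂ) (ComplexPoints X) 2 (B.isoObj X 2 η)) n := by
  sorry

/-- Stub 2: `ι ∘ B.iso` intertwines the Lefschetz iterates of `W` with those of singular cohomology.
[HatcherAT2002 Prop. 3.10; Kleiman1968 §1.4] -/
theorem stub_ringChange_iso_lefschetzPow :
    ∀ (B : BettiHodgeData ℂ) ⦃n : ℕ⦄ ⦃X : SchemeOver ℂ⦄ (_hX : IsSmoothProjective n X) (η : B.W.obj X 2)
      ⦃i r j : ℕ⦄ (h : i + 2 * r = j) (b : B.W.obj X i),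
      singularCohomology.ringChange (algebraMap ℚ ℂ) (ComplexPoints X) j
          (B.isoObj X j (B.W.lefschetzPow X η r i j h b)) =
        lefschetzPowTo (singularCohomology.ringChange (algebraMap ℚ ℂ) (ComplexPoints X) 2 (B.isoObj X 2 η))
          r i j h (singularCohomology.ringChange (algebraMap ℚ ℂ) (ComplexPoints X) i (B.isoObj X i b)) := by
  sorry

/-- Composition: the two stubs give P2. -/
theorem BettiHardLefschetz_of
    (h₁ : ∀ (B : BettiHodgeData ℂ) ⦃n : ℕ⦄ ⦃X : SchemeOver ℂ⦄ (_hX : IsSmoothProjective n X)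
      (η : B.W.obj X 2), B.W.IsHyperplaneClass X η →
        HasHardLefschetzProperty
          (singularCohomology.ringChange (algebraMap ℚ ℂ) (ComplexPoints X) 2 (B.isoObj X 2 η)) n)
    (h₂ : ∀ (B : BettiHodgeData ℂ) ⦃n : ℕ⦄ ⦃X : SchemeOver ℂ⦄ (_hX : IsSmoothProjective n X)
      (η : B.W.obj X 2) ⦃i r j : ℕ⦄ (h : i + 2 * r = j) (b : B.W.obj X i),
      singularCohomology.ringChange (algebraMap ℚ ℂ) (ComplexPoints X) j
          (B.isoObj X j (B.W.lefschetzPow X η r i j h b)) =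
        lefschetzPowTo (singularCohomology.ringChange (algebraMap ℚ ℂ) (ComplexPoints X) 2 (B.isoObj X 2 η))
          r i j h (singularCohomology.ringChange (algebraMap ℚ ℂ) (ComplexPoints X) i (B.isoObj X i b))) :
    ∀ B : BettiHodgeData ℂ, B.W.HasHardLefschetz := by
  intro B
  rw [WeilCohomology.hasHardLefschetz_iff_injective]
  intro n X hX η hη i r j hr h b b' hbb'
  -- transport the equality `Lʳ b = Lʳ b'` to singular cohomology with complex coefficients
  have key := congrArg
    (fun c ↦ singularCohomology.ringChange (algebraMap ℚ ℂ) (ComplexPoints X) j (B.isoObj X j c)) hbb'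
  rw [h₂ B hX η h b, h₂ B hX η h b'] at key
  -- hard Lefschetz for the transported class: `Lʳ` is injective on `Hⁱ(X(ℂ); ℂ)`, `i + r = n`
  have hinj := (bijective_lefschetzPowTo_of_hasHardLefschetz _ (h₁ B hX η hη) hr j h).1 key
  exact (B.isoObj X i).injective (ringChange_rat_injective hinj)

/-- P2 from the stubs. -/
theorem bettiHardLefschetz : ∀ B : BettiHodgeData ℂ, B.W.HasHardLefschetz :=
  BettiHardLefschetz_of stub_hasHardLefschetzProperty_ringChange_iso stub_ringChange_iso_lefschetzPow

end Summit.HodgeConjecture.HodgeConjecture.Cruxes.ClassicalBridge.PiecesSplit.P2
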